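import Mathlib
import Literature.Geometry.Symplectic.SteinBall
import Summits.SmoothPoincare4.SmoothPoincare4.Theorems.HyperbolicEnd.Negative.PsiContDiff
import Summits.SmoothPoincare4.SmoothPoincare4.Theorems.HyperbolicEnd.Negative.LineGrowthE4
import Summits.SmoothPoincare4.SmoothPoincare4.Theorems.HyperbolicEnd.Negative.StripMax
import Summits.SmoothPoincare4.SmoothPoincare4.Theorems.HyperbolicEnd.Negative.ShellWitness
import Summits.SmoothPoincare4.SmoothPoincare4.Theorems.HyperbolicEnd.Negative.ExpCurve

/-!
# `HyperbolicEnd` (stmt-SmoothPoincare4-7825), line `Sketch`, negative side — frozen-`J` certificate filling is false on `ℝ⁴`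

Driver of the native frozen refutation (stub helper_certificateFill_frozen_false, registered on
the crux item): the flat filling stub `stub_certificateFill` of the line `Sketch`, with the
almost complex structure of the filling FROZEN to the given one (`J' := J`), is FALSE already for
the standard complex structure `J = J₀ = stdComplexStructure` of `ℝ⁴ = ℂ²`.

**The counterexample.** On the shell `1 < ‖x‖ < 4` (`a = 0`, `r₁ = 1`, `r₂ = 2`, `r₃ = 4`) take
the conformally flat density `F(x, v) = e^{2ψ_M(x)} ‖v‖²` with
`ψ_M x = -8 χ(q₂ x) log (q₁ x + 10⁻³) + M q₂ x + (q₁ x + q₂ x)`, `q₁ = x₀² + x₁²`,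
`q₂ = x₂² + x₃²`, `χ t = smoothTransition ((81/100 - t)(25/14))`.  It is smooth
(`helper_frozen_psiContDiff`), positive definite, and for suitable `M ≥ 0`, `c > 0` certified along
every local `J₀`-holomorphic curve into the shell (`helper_frozen_shellWitness`, sibling file).

**No frozen filling.** Suppose `(J₀, F', c')` is a certified positive definite filling over
`‖x‖ < 4` agreeing with `F` on `2 < ‖x‖ < 4`.  Pull it back along the entire `J₀`-holomorphic
curve `G(w) = (re eʷ) e₀ + (im eʷ) J₀ e₀` (the punctured first complex line,
`helper_frozen_expCurve`: `∂ₓG = G`, `‖G w‖ = e^{re w}`, `G(w + 2πi) = G(w)`, `x₂ = x₃ = 0` along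
`G`) restricted to `re w < log 4`: `Λ(w) = F'(G w)(G w)` is `C²`, positive, `2πi`-periodic and
certified.  On `log 2 < re w < log 4` it is known (`χ = 1` on the line):
`Λ e^{-re w} = r e^{2r²}/(r² + 10⁻³)¹⁶`, `r = e^{re w}`, which is *larger* at `r = 41/20` than on
the line `r = 13/5` (`numeric_alpha`); far to the left (`r = min 1 c' · 10⁻¹²`) the Schwarz-type
growth bound `F'(x, v) ≤ 16‖v‖²/(c'(4 - ‖x‖)²)` (`helper_frozen_lineGrowthE4`) makes
`Λ e^{-re w}` smaller still (`numeric_beta`).  The strip maximum principle for certified periodic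
densities (`helper_frozen_stripMax`) then yields `False`.
-/

noncomputable section

-- the prescribed namespace `Summit.<P>.<Sub>.…` duplicates `SmoothPoincare4` (P = Sub)
set_option linter.dupNamespace false

open scoped ContDiff Topology Real
open Laplacian Set Filter Metric Complex
open Literature.Geometry.Symplectic

namespace Summit.SmoothPoincare4.SmoothPoincare4.Theorems.HyperbolicEnd.Negative

/-! ### Numerics -/

/-- `(α)` The weighted density on the line `r = 13/5` is below its value at `r = 41/20`:
`(13/5) e^{2(13/5)²}/((13/5)² + 10⁻³)¹⁶ < (41/20) e^{2(41/20)²}/((41/20)² + 10⁻³)¹⁶`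
(split off `e^{1023/200} ≤ e⁶ < 3⁶`, then rational arithmetic). -/
private theorem numeric_alpha :
    13 / 5 * Real.exp (2 * (13 / 5) ^ 2) / ((13 / 5) ^ 2 + 1 / 1000) ^ 16 <
      41 / 20 * Real.exp (2 * (41 / 20) ^ 2) / ((41 / 20 : ℝ) ^ 2 + 1 / 1000) ^ 16 := by
  have hsplit : Real.exp (2 * (13 / 5 : ℝ) ^ 2) =
      Real.exp (2 * (41 / 20) ^ 2) * Real.exp (1023 / 200) := by
    rw [← Real.exp_add]
    norm_num
  have h6 : Real.exp (6 : ℝ) = Real.exp 1 ^ 6 := by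
    rw [Real.exp_one_pow]
    norm_num
  have hd : Real.exp (1023 / 200 : ℝ) < 729 :=
    calc Real.exp (1023 / 200 : ℝ) ≤ Real.exp 6 := Real.exp_le_exp.2 (by norm_num)
      _ = Real.exp 1 ^ 6 := h6
      _ < 3 ^ 6 := by
        gcongr
        exact Real.exp_one_lt_d9.trans (by norm_num)
      _ = 729 := by norm_num
  have hE : 0 < Real.exp (2 * (41 / 20 : ℝ) ^ 2) := Real.exp_pos _
  rw [hsplit]
  calc 13 / 5 * (Real.exp (2 * (41 / 20) ^ 2) * Real.exp (1023 / 200)) /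
        ((13 / 5) ^ 2 + 1 / 1000) ^ 16
      < 13 / 5 * (Real.exp (2 * (41 / 20) ^ 2) * 729) / ((13 / 5) ^ 2 + 1 / 1000) ^ 16 := by
        gcongr
    _ = Real.exp (2 * (41 / 20) ^ 2) * (13 / 5 * 729 / ((13 / 5) ^ 2 + 1 / 1000) ^ 16) := by
        ring
    _ ≤ Real.exp (2 * (41 / 20) ^ 2) * (41 / 20 / ((41 / 20) ^ 2 + 1 / 1000) ^ 16) :=
        mul_le_mul_of_nonneg_left (by norm_num) hE.le
    _ = 41 / 20 * Real.exp (2 * (41 / 20) ^ 2) / ((41 / 20) ^ 2 + 1 / 1000) ^ 16 := by ring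

/-- `(β)` The far-left bound `16/(9·10¹²)` is below the value of the weighted density at
`r = 41/20` (use `e^{2(41/20)²} ≥ 1`, then rational arithmetic). -/
private theorem numeric_beta :
    (16 : ℝ) / (9 * 1000000000000) <
      41 / 20 * Real.exp (2 * (41 / 20) ^ 2) / ((41 / 20 : ℝ) ^ 2 + 1 / 1000) ^ 16 := by
  have h1 : (1 : ℝ) ≤ Real.exp (2 * (41 / 20) ^ 2) := Real.one_le_exp (by norm_num)
  calc (16 : ℝ) / (9 * 1000000000000)
      < 41 / 20 * 1 / ((41 / 20 : ℝ) ^ 2 + 1 / 1000) ^ 16 := by norm_num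
    _ ≤ 41 / 20 * Real.exp (2 * (41 / 20) ^ 2) / ((41 / 20 : ℝ) ^ 2 + 1 / 1000) ^ 16 := by
        gcongr

/-! ### The weighted density `Λ e^{-re}` on three vertical lines -/

/-- On a line `re z = log r` with `2 < r < 4` the weighted density of a filling is
`r e^{2r²}/(r² + 10⁻³)¹⁶`. -/
private theorem weighted_at {Λ : ℂ → ℝ}
    (hknown : ∀ z : ℂ, Real.log 2 < z.re → z.re < Real.log 4 →
      Λ z = Real.exp (2 * (Real.exp z.re ^ 2 - 8 * Real.log (Real.exp z.re ^ 2 + 1 / 1000))) *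
        Real.exp z.re ^ 2)
    {r : ℝ} (h2 : 2 < r) (h4 : r < 4) {z : ℂ} (hz : z.re = Real.log r) :
    Λ z * Real.exp (-z.re) = r * Real.exp (2 * r ^ 2) / (r ^ 2 + 1 / 1000) ^ 16 := by
  have hr : 0 < r := by linarith
  have hr' : r ≠ 0 := hr.ne'
  have h2' : Real.log 2 < z.re := hz ▸ Real.log_lt_log two_pos h2
  have h4' : z.re < Real.log 4 := hz ▸ Real.log_lt_log hr h4
  have hε : 0 < r ^ 2 + 1 / 1000 := by positivity
  have hA : (r ^ 2 + 1 / 1000) ^ 16 ≠ 0 := (pow_pos hε 16).ne'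
  have h16 : Real.exp (2 * (8 * Real.log (r ^ 2 + 1 / 1000))) = (r ^ 2 + 1 / 1000) ^ 16 := by
    rw [← Real.exp_log (pow_pos hε 16), Real.log_pow]
    congr 1
    push_cast
    ring
  rw [hknown z h2' h4', hz, Real.exp_neg, Real.exp_log hr, mul_sub, Real.exp_sub, h16]
  field_simp

/-- On the line `re z = log (13/5)` the weighted density is below its value at
`p = log (41/20)`. -/
private theorem weighted_right {Λ : ℂ → ℝ}
    (hknown : ∀ z : ℂ, Real.log 2 < z.re → z.re < Real.log 4 →
      Λ z = Real.exp (2 * (Real.exp z.re ^ 2 - 8 * Real.log (Real.exp z.re ^ 2 + 1 / 1000))) *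
        Real.exp z.re ^ 2)
    {z : ℂ} (hz : z.re = Real.log (13 / 5)) :
    Λ z * Real.exp (-z.re) <
      Λ ((Real.log (41 / 20) : ℝ) : ℂ) * Real.exp (-((Real.log (41 / 20) : ℝ) : ℂ).re) := by
  rw [weighted_at hknown (by norm_num) (by norm_num) hz,
    weighted_at hknown (by norm_num) (by norm_num) (Complex.ofReal_re _)]
  exact numeric_alpha

/-- On the far-left line `re z = log (min 1 c' · 10⁻¹²)` the growth bound
`Λ ≤ 16 e^{2 re}/(c'(4 - e^{re})²)` forces the weighted density below its value at
`p = log (41/20)`. -/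
private theorem weighted_left {Λ : ℂ → ℝ} {c' : ℝ} (hc' : 0 < c')
    (hleft : ∀ z : ℂ, z.re < Real.log 4 →
      Λ z ≤ 16 * Real.exp z.re ^ 2 / (c' * (4 - Real.exp z.re) ^ 2))
    (hknown : ∀ z : ℂ, Real.log 2 < z.re → z.re < Real.log 4 →
      Λ z = Real.exp (2 * (Real.exp z.re ^ 2 - 8 * Real.log (Real.exp z.re ^ 2 + 1 / 1000))) *
        Real.exp z.re ^ 2)
    {z : ℂ} (hz : z.re = Real.log (min 1 c' / 1000000000000)) :
    Λ z * Real.exp (-z.re) <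
      Λ ((Real.log (41 / 20) : ℝ) : ℂ) * Real.exp (-((Real.log (41 / 20) : ℝ) : ℂ).re) := by
  set m : ℝ := min 1 c' / 1000000000000 with hm
  have hmin : 0 < min 1 c' := lt_min one_pos hc'
  have hm0 : 0 < m := by positivity
  have hm1 : m ≤ 1 := by
    have := min_le_left 1 c'
    rw [hm]
    linarith
  have hmc : m ≤ c' / 1000000000000 := by
    rw [hm]
    gcongr
    exact min_le_right 1 c'
  have hexp : Real.exp z.re = m := by rw [hz, Real.exp_log hm0]
  have h4 : z.re < Real.log 4 := by
    rw [hz]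
    exact Real.log_lt_log hm0 (by linarith)
  have hΛ := hleft z h4
  rw [hexp] at hΛ
  rw [weighted_at hknown (by norm_num) (by norm_num) (Complex.ofReal_re _), Real.exp_neg, hexp]
  have h9 : (9 : ℝ) ≤ (4 - m) ^ 2 := by nlinarith
  have h9c : c' * 9 ≤ c' * (4 - m) ^ 2 := mul_le_mul_of_nonneg_left h9 hc'.le
  have hden : 0 < c' * (4 - m) ^ 2 := by positivity
  calc Λ z * m⁻¹ ≤ 16 * m ^ 2 / (c' * (4 - m) ^ 2) * m⁻¹ := by gcongr
    _ = 16 * m / (c' * (4 - m) ^ 2) := by field_simp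
    _ ≤ 16 * m / (c' * 9) := div_le_div_of_nonneg_left (by positivity) (by positivity) h9c
    _ ≤ 16 / (9 * 1000000000000) := by
        rw [div_le_div_iff₀ (by positivity) (by norm_num)]
        linarith
    _ < 41 / 20 * Real.exp (2 * (41 / 20) ^ 2) / ((41 / 20 : ℝ) ^ 2 + 1 / 1000) ^ 16 :=
        numeric_beta

/-! ### No certified filling density along the exponential curve -/

/-- No `C²`, positive, `2πi`-periodic, certified density `Λ` on `re w < log 4` has the known values
`e^{2(r² - 8 log (r² + 10⁻³))} r²` (`r = e^{re w}`) on `log 2 < re w < log 4` together with the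
growth bound `Λ ≤ 16 e^{2 re}/(c'(4 - e^{re})²)`: strip maximum principle between the lines
`re = log (min 1 c' · 10⁻¹²)` and `re = log (13/5)`, tested at `p = log (41/20)`. -/
private theorem no_density4 (Λ : ℂ → ℝ) (c' : ℝ) (hc' : 0 < c')
    (hC2 : ContDiffOn ℝ 2 Λ {w : ℂ | w.re < Real.log 4})
    (hineq : ∀ z : ℂ, z.re < Real.log 4 → 2 * c' * Λ z ^ 3 ≤
      Λ z * (Δ Λ) z - ((fderiv ℝ Λ z 1) ^ 2 + (fderiv ℝ Λ z Complex.I) ^ 2))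
    (hpos : ∀ z : ℂ, z.re < Real.log 4 → 0 < Λ z)
    (hper : Function.Periodic Λ (2 * π * Complex.I))
    (hknown : ∀ z : ℂ, Real.log 2 < z.re → z.re < Real.log 4 →
      Λ z = Real.exp (2 * (Real.exp z.re ^ 2 - 8 * Real.log (Real.exp z.re ^ 2 + 1 / 1000))) *
        Real.exp z.re ^ 2)
    (hleft : ∀ z : ℂ, z.re < Real.log 4 →
      Λ z ≤ 16 * Real.exp z.re ^ 2 / (c' * (4 - Real.exp z.re) ^ 2)) : False := by
  have hmin : 0 < min 1 c' := lt_min one_pos hc'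
  have hs₀ : Real.log (min 1 c' / 1000000000000) < ((Real.log (41 / 20) : ℝ) : ℂ).re := by
    rw [Complex.ofReal_re]
    exact Real.log_lt_log (by positivity) (by have := min_le_left 1 c'; linarith)
  have hs₁ : ((Real.log (41 / 20) : ℝ) : ℂ).re < Real.log (13 / 5) := by
    rw [Complex.ofReal_re]
    exact Real.log_lt_log (by norm_num) (by norm_num)
  have hL : Real.log (13 / 5) < Real.log 4 := Real.log_lt_log (by norm_num) (by norm_num)
  exact helper_frozen_stripMax Λ c' (Real.log 4) (Real.log (min 1 c' / 1000000000000))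
    (Real.log (13 / 5)) ((Real.log (41 / 20) : ℝ) : ℂ) hc' hs₀ hs₁ hL hC2 hineq hpos hper
    (fun z hz => weighted_left hc' hleft hknown hz) (fun z hz => weighted_right hknown hz)

/-- **No frozen filling along the exponential curve.** If `F'` is positive definite over
`‖x‖ < 4`, certified there with `c' > 0` along local `J₀`-holomorphic curves, and takes the shell
values `e^{2(r² - 8 log (r² + 10⁻³))} r²` on `G` for `log 2 < re w < log 4`, where `G` is a smooth
entire `J₀`-holomorphic curve with `∂ₓG = G`, `‖G w‖ = e^{re w}`, `G (w + 2πi) = G w`, then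
`False`: the pulled-back density `Λ = F'(G)(G)` on `re w < log 4` is excluded by `no_density4`
(growth bound from `helper_frozen_lineGrowthE4`). -/
private theorem no_filling (F' : EuclideanSpace ℝ (Fin 4) → EuclideanSpace ℝ (Fin 4) → ℝ)
    (c' : ℝ) (G : ℂ → EuclideanSpace ℝ (Fin 4)) (hc' : 0 < c')
    (hposF : ∀ x ∈ Metric.ball (0 : EuclideanSpace ℝ (Fin 4)) 4, ∀ v : EuclideanSpace ℝ (Fin 4),
      0 ≤ F' x v ∧ (F' x v = 0 → v = 0))
    (hcert : ∀ (U : Set ℂ) (g : ℂ → EuclideanSpace ℝ (Fin 4)), IsOpen U → ContDiffOn ℝ ∞ g U →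
      (∀ z ∈ U, ∀ ζ : ℂ, fderiv ℝ g z (Complex.I * ζ) = stdComplexStructure (fderiv ℝ g z ζ)) →
      (∀ z ∈ U, g z ∈ Metric.ball (0 : EuclideanSpace ℝ (Fin 4)) 4) →
      ContDiffOn ℝ 2 (fun w => F' (g w) (fderiv ℝ g w 1)) U ∧
        ∀ z ∈ U, 2 * c' * (F' (g z) (fderiv ℝ g z 1)) ^ 3 ≤
          F' (g z) (fderiv ℝ g z 1) * (Δ (fun w => F' (g w) (fderiv ℝ g w 1))) z -
            ((fderiv ℝ (fun w => F' (g w) (fderiv ℝ g w 1)) z 1) ^ 2 +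
              (fderiv ℝ (fun w => F' (g w) (fderiv ℝ g w 1)) z Complex.I) ^ 2))
    (hGsmooth : ContDiff ℝ ∞ G)
    (hGhol : ∀ w ζ : ℂ, fderiv ℝ G w (Complex.I * ζ) = stdComplexStructure (fderiv ℝ G w ζ))
    (hG1 : ∀ w : ℂ, fderiv ℝ G w 1 = G w) (hGnorm : ∀ w : ℂ, ‖G w‖ = Real.exp w.re)
    (hGper : ∀ w : ℂ, G (w + 2 * π * Complex.I) = G w)
    (hknown : ∀ z : ℂ, Real.log 2 < z.re → z.re < Real.log 4 →
      F' (G z) (G z) = Real.exp (2 * (Real.exp z.re ^ 2 -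
        8 * Real.log (Real.exp z.re ^ 2 + 1 / 1000))) * Real.exp z.re ^ 2) : False := by
  have hU : IsOpen {w : ℂ | w.re < Real.log 4} := isOpen_lt Complex.continuous_re continuous_const
  have hball : ∀ w ∈ {w : ℂ | w.re < Real.log 4},
      G w ∈ Metric.ball (0 : EuclideanSpace ℝ (Fin 4)) 4 := by
    intro w hw
    rw [mem_ball_zero_iff, hGnorm]
    calc Real.exp w.re < Real.exp (Real.log 4) := Real.exp_lt_exp.mpr hw
      _ = 4 := Real.exp_log (by norm_num)
  have hGne : ∀ w : ℂ, G w ≠ 0 := fun w h0 => by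
    have h := hGnorm w
    rw [h0, norm_zero] at h
    exact (Real.exp_pos w.re).ne h
  -- pull the certificate back along the `J₀`-holomorphic curve `G`, and use `∂ₓG = G`
  obtain ⟨hC2, hineq⟩ := hcert {w : ℂ | w.re < Real.log 4} G hU hGsmooth.contDiffOn
    (fun z _ ζ => hGhol z ζ) hball
  simp only [hG1] at hC2 hineq
  refine no_density4 (fun w => F' (G w) (G w)) c' hc' hC2 hineq ?_ ?_ ?_ ?_
  · -- positivity: `G w ≠ 0` and `F'` is positive definite over the ball
    intro z hz
    have h := hposF (G z) (hball z hz) (G z)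
    exact lt_of_le_of_ne h.1 fun h0 => hGne z (h.2 h0.symm)
  · -- periodicity of `G`
    intro z
    show F' _ _ = F' _ _
    rw [hGper z]
  · -- the known region
    intro z h2 h4
    exact hknown z h2 h4
  · -- growth at the far left, along the `J₀`-complex line through `G z` in direction `G z`
    intro z hz
    have h := helper_frozen_lineGrowthE4 F' c' 4 (G z) (G z) hc'
      (mem_ball_zero_iff.mp (hball z hz)) (hGne z) hposF hcert
    rw [hGnorm] at h
    exact h

/-! ### The shell datum `F(x, v) = e^{2ψ_M(x)} ‖v‖²` -/

/-- The shell density `e^{2ψ_M(x)} ‖v‖²` is smooth on `ℝ⁴ × ℝ⁴`, in particular on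
`(shell) × ℝ⁴` (`helper_frozen_psiContDiff`). -/
private theorem shell_contDiffOn (M : ℝ) :
    ContDiffOn ℝ ∞ (fun y : EuclideanSpace ℝ (Fin 4) × EuclideanSpace ℝ (Fin 4) =>
      Real.exp (2 * (-8 * Real.smoothTransition ((81 / 100 - (y.1 2 ^ 2 + y.1 3 ^ 2)) *
        (25 / 14)) * Real.log (y.1 0 ^ 2 + y.1 1 ^ 2 + 1 / 1000) + M * (y.1 2 ^ 2 + y.1 3 ^ 2) +
        (y.1 0 ^ 2 + y.1 1 ^ 2 + y.1 2 ^ 2 + y.1 3 ^ 2))) * ‖y.2‖ ^ 2)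
      ((Metric.ball (0 : EuclideanSpace ℝ (Fin 4)) 4 \
        Metric.closedBall (0 : EuclideanSpace ℝ (Fin 4)) 1) ×ˢ Set.univ) := by
  have h1 : ContDiff ℝ ∞ (fun y : EuclideanSpace ℝ (Fin 4) × EuclideanSpace ℝ (Fin 4) =>
      -8 * Real.smoothTransition ((81 / 100 - (y.1 2 ^ 2 + y.1 3 ^ 2)) * (25 / 14)) *
        Real.log (y.1 0 ^ 2 + y.1 1 ^ 2 + 1 / 1000) + M * (y.1 2 ^ 2 + y.1 3 ^ 2) +
        (y.1 0 ^ 2 + y.1 1 ^ 2 + y.1 2 ^ 2 + y.1 3 ^ 2)) :=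
    (helper_frozen_psiContDiff M).comp contDiff_fst
  have h2 : ContDiff ℝ ∞ (fun y : EuclideanSpace ℝ (Fin 4) × EuclideanSpace ℝ (Fin 4) =>
      ‖y.2‖ ^ 2) := (contDiff_norm_sq ℝ).comp contDiff_snd
  exact ((contDiff_const.mul h1).exp.mul h2).contDiffOn

/-- The shell density `e^{2ψ_M(x)} ‖v‖²` is positive definite (everywhere). -/
private theorem shell_posDef (M : ℝ) :
    ∀ x ∈ Metric.ball (0 : EuclideanSpace ℝ (Fin 4)) 4 \
        Metric.closedBall (0 : EuclideanSpace ℝ (Fin 4)) 1, ∀ v : EuclideanSpace ℝ (Fin 4),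
      0 ≤ Real.exp (2 * (-8 * Real.smoothTransition ((81 / 100 - (x 2 ^ 2 + x 3 ^ 2)) *
        (25 / 14)) * Real.log (x 0 ^ 2 + x 1 ^ 2 + 1 / 1000) + M * (x 2 ^ 2 + x 3 ^ 2) +
        (x 0 ^ 2 + x 1 ^ 2 + x 2 ^ 2 + x 3 ^ 2))) * ‖v‖ ^ 2 ∧
      (Real.exp (2 * (-8 * Real.smoothTransition ((81 / 100 - (x 2 ^ 2 + x 3 ^ 2)) *
        (25 / 14)) * Real.log (x 0 ^ 2 + x 1 ^ 2 + 1 / 1000) + M * (x 2 ^ 2 + x 3 ^ 2) +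
        (x 0 ^ 2 + x 1 ^ 2 + x 2 ^ 2 + x 3 ^ 2))) * ‖v‖ ^ 2 = 0 → v = 0) := by
  intro x _ v
  refine ⟨by positivity, fun h => ?_⟩
  rcases mul_eq_zero.1 h with h' | h'
  · exact absurd h' (Real.exp_pos _).ne'
  · exact norm_eq_zero.1 (pow_eq_zero_iff two_ne_zero |>.1 h')

/-! ### The registered statement -/

/-- lead c3 (negative side of line `Sketch`, stub D3): **frozen-`J` certificate filling is false
on `ℝ⁴`.**  The flat filling stub `stub_certificateFill` with the filling's almost complex
structure frozen to the given one (`J' := J`) fails for `J = J₀`, `a = 0`, `r₁ = 1`, `r₂ = 2`,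
`r₃ = 4` and the certified shell germ `F = e^{2ψ_M}‖v‖²` of `helper_frozen_shellWitness`
(`shell_contDiffOn`, `shell_posDef`): a certified filling `(J₀, F', c')` pulled back along the
exponential curve of `helper_frozen_expCurve` is excluded by `no_filling`. -/
theorem helper_certificateFill_frozen_false : ¬ (∀ (J : EuclideanSpace ℝ (Fin 4) → EuclideanSpace ℝ (Fin 4) →L[ℝ] EuclideanSpace ℝ (Fin 4)) (F : EuclideanSpace ℝ (Fin 4) → EuclideanSpace ℝ (Fin 4) → ℝ) (a : EuclideanSpace ℝ (Fin 4)) (r₁ r₂ r₃ c : ℝ), 0 < r₁ → r₁ < r₂ → r₂ < r₃ → 0 < c → ContDiffOn ℝ ∞ J (Metric.ball a r₃) → (∀ x ∈ Metric.ball a r₃, ∀ v, J x (J x v) = -v) → ContDiffOn ℝ ∞ (fun y : (EuclideanSpace ℝ (Fin 4)) × (EuclideanSpace ℝ (Fin 4)) => F y.1 y.2) ((Metric.ball a r₃ \ Metric.closedBall a r₁) ×ˢ Set.univ) → (∀ x ∈ Metric.ball a r₃ \ Metric.closedBall a r₁, ∀ v, 0 ≤ F x v ∧ (F x v = 0 →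 v = 0)) → (∀ (U : Set ℂ) (g : ℂ → EuclideanSpace ℝ (Fin 4)), IsOpen U → ContDiffOn ℝ ∞ g U → (∀ z ∈ U, ∀ ζ : ℂ, fderiv ℝ g z (Complex.I * ζ) = J (g z) (fderiv ℝ g z ζ)) → (∀ z ∈ U, g z ∈ Metric.ball a r₃ \ Metric.closedBall a r₁) → ContDiffOn ℝ 2 (fun w => F (g w) (fderiv ℝ g w 1)) U ∧ ∀ z ∈ U, 2 * c * (F (g z) (fderiv ℝ g z 1)) ^ 3 ≤ F (g z) (fderiv ℝ g z 1) * (Δ (fun w => F (g w) (fderiv ℝ g w 1))) z - ((fderiv ℝ (fun w => F (g w) (fderiv ℝ g w 1)) z 1) ^ 2 + (fderiv ℝ (fun w => F (g w) (fderiv ℝ g w 1)) z Complex.I) ^ 2)) → ∃ (F' : EuclideanSpace ℝ (Fin 4) → EuclideanSpace ℝ (Fin 4) → ℝ) (c' : ℝ), 0 < c' ∧ (∀ x ∈ Metric.ball a r₃ \ Metric.closedBall a r₂, ∀ v, F' x v = F x v) ∧ (∀ x ∈ Metric.ball a r₃, ∀ v, 0 ≤ F' x v ∧ (F' x v = 0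 → v = 0)) ∧ (∀ (U : Set ℂ) (g : ℂ → EuclideanSpace ℝ (Fin 4)), IsOpen U → ContDiffOn ℝ ∞ g U → (∀ z ∈ U, ∀ ζ : ℂ, fderiv ℝ g z (Complex.I * ζ) = J (g z) (fderiv ℝ g z ζ)) → (∀ z ∈ U, g z ∈ Metric.ball a r₃) → ContDiffOn ℝ 2 (fun w => F' (g w) (fderiv ℝ g w 1)) U ∧ ∀ z ∈ U, 2 * c' * (F' (g z) (fderiv ℝ g z 1)) ^ 3 ≤ F' (g z) (fderiv ℝ g z 1) * (Δ (fun w => F' (g w) (fderiv ℝ g w 1))) z - ((fderiv ℝ (fun w => F' (g w) (fderiv ℝ g w 1)) z 1) ^ 2 + (fderiv ℝ (fun w => F' (g w) (fderiv ℝ g w 1)) z Complex.I) ^ 2))) := by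
  intro h
  obtain ⟨M, c, -, hc, hcertF⟩ := helper_frozen_shellWitness
  -- the flat filling statement applied to the shell germ `(J₀, e^{2ψ_M}‖v‖², c)`
  obtain ⟨F', c', hc', hagree, hpos', hcert'⟩ := h (fun _ => stdComplexStructure)
    (fun x v => Real.exp (2 * (-8 * Real.smoothTransition ((81 / 100 - (x 2 ^ 2 + x 3 ^ 2)) *
      (25 / 14)) * Real.log (x 0 ^ 2 + x 1 ^ 2 + 1 / 1000) + M * (x 2 ^ 2 + x 3 ^ 2) +
      (x 0 ^ 2 + x 1 ^ 2 + x 2 ^ 2 + x 3 ^ 2))) * ‖v‖ ^ 2)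
    0 1 2 4 c one_pos (by norm_num) (by norm_num) hc contDiffOn_const
    (fun x _ v => stdComplexStructure_sq v) (shell_contDiffOn M) (shell_posDef M) hcertF
  clear h hcertF
  -- the exponential curve `G` in the first complex line
  obtain ⟨hGsmooth, hGhol, hG1, hGnorm, hGcoord, hGper⟩ := helper_frozen_expCurve
  set G : ℂ → EuclideanSpace ℝ (Fin 4) := fun w : ℂ => (Complex.exp w).re •
    EuclideanSpace.single (0 : Fin 4) (1 : ℝ) + (Complex.exp w).im •
      stdComplexStructure (EuclideanSpace.single (0 : Fin 4) (1 : ℝ))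
  replace hG1 : ∀ w : ℂ, fderiv ℝ G w 1 = G w := hG1
  replace hGnorm : ∀ w : ℂ, ‖G w‖ = Real.exp w.re := hGnorm
  replace hGcoord : ∀ w : ℂ, (G w) 0 ^ 2 + (G w) 1 ^ 2 = Real.exp w.re ^ 2 ∧ (G w) 2 = 0 ∧
      (G w) 3 = 0 := hGcoord
  replace hGper : ∀ w : ℂ, G (w + 2 * π * Complex.I) = G w := hGper
  -- the known values of the filling along `G` on `log 2 < re z < log 4` (`χ = 1` there)
  have hknown : ∀ z : ℂ, Real.log 2 < z.re → z.re < Real.log 4 →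
      F' (G z) (G z) = Real.exp (2 * (Real.exp z.re ^ 2 -
        8 * Real.log (Real.exp z.re ^ 2 + 1 / 1000))) * Real.exp z.re ^ 2 := by
    intro z h2z h4z
    have hmem : G z ∈ Metric.ball (0 : EuclideanSpace ℝ (Fin 4)) 4 \
        Metric.closedBall (0 : EuclideanSpace ℝ (Fin 4)) 2 := by
      rw [Set.mem_sdiff, mem_ball_zero_iff, mem_closedBall_zero_iff, not_le, hGnorm]
      constructor
      · calc Real.exp z.re < Real.exp (Real.log 4) := Real.exp_lt_exp.2 h4z
          _ = 4 := Real.exp_log (by norm_num)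
      · calc (2 : ℝ) = Real.exp (Real.log 2) := (Real.exp_log (by norm_num)).symm
          _ < Real.exp z.re := Real.exp_lt_exp.2 h2z
    obtain ⟨h01, h2, h3⟩ := hGcoord z
    have hχ : Real.smoothTransition ((81 / 100 - ((G z) 2 ^ 2 + (G z) 3 ^ 2)) * (25 / 14)) = 1 :=
      Real.smoothTransition.one_of_one_le (by rw [h2, h3]; norm_num)
    rw [hagree _ hmem (G z), hχ, h2, h3, h01, hGnorm z]
    congr 1
    congr 1
    ring
  exact no_filling F' c' G hc' hpos' hcert' hGsmooth hGhol hG1 hGnorm hGper hknown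

end Summit.SmoothPoincare4.SmoothPoincare4.Theorems.HyperbolicEnd.Negative

end
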